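import Summits.SmoothPoincare4.SmoothPoincare4.Theorems.NormalFormStablyTrivial.Negative.TripleLoadBearing
import Summits.SmoothPoincare4.SmoothPoincare4.Theorems.CongruenceShadowsShadowApproximationStubGoeritzRealisationPos
import Literature.Topology.FourManifolds.TrisectionFunctorGKStabilizationSplit
import Literature.Topology.FourManifolds.SurfaceGroupCutKernels

/-!
# Line `luft-twist-reduction` for crux `NormalFormStablyTrivial` (stmt-SmoothPoincare4-14591):
# vocabulary, statements of the registered stubs, and the sorry-free composition (skeleton v2)

Crux (route `CongruenceShadows`, rank-0 target): every `(3+3m, m+1)` group trisection `K` of the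
trivial group in Waldhausen normal form is stably trivial.  GATE FORM (`Negative.InGate m K`,
`TripleLoadBearing.lean`): `K₀ = N₀`, `K₁ = N₁`, `π₁ = 1`, `K₂ ∈ Stab(N₀)·N₂ ∩ Stab(N₁)·N₂`
(`N = s4Kernels.stabilizeIter m`); modulo Nielsen's lifting theorem the crux IS
`∀ m K, InGate m K → K.IsStablyTrivial` (`normalFormStablyTrivial_iff_gate_of_nielsen`).

LINE (crux idea `luft-twist-reduction` merged with `free-shadow-twist-core`; triage r1 PASS twice;
planner-cstrat skeleton v1 `Cruxes/NormalFormStablyTrivial/Lines/luft_twist_reduction.lean`; lead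
c3 reshaping = this v2).  Read the gate triple through the middle handlebody `H₁`:
`F = S/N₁ = π₁(H₁)` is free of rank `3+3m` (erasure `eraseN1`), the only `π₁`-level datum of a gate
triple that is not standard is its FREE SHADOW `Q = erase(K₂) = θ(P₂) ◁ F` (`θ` induced by the gate
automorphism `γ ∈ Stab N₁`), transverse to `P₀ = erase(N₀)` because `π₁ = 1`.  After `m+1` further
stabilisations the pair `(P₀', Q')` is standardised by a product `v` of PADDING MOVES
(`paddingGens`: right transvections `xᵢ ↦ xᵢ·x_t` by a TRIVIAL letter `x_t`, `t ≢ 0 (mod 3)`, and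
partial conjugations `x_t ↦ x_j⁻¹ x_t x_j` of a trivial letter; TRIAGE-r1-2 App. A) —
`FreePadding`, a theorem about free groups only; each padding move is induced on `F` by an element
of the GOERITZ GROUP `Stab N₀ ∩ Stab N₁` (`MovesGoeritz`: handle slides corrected by meridian
transvections, annulus twists).  Hence (`PaddingTransfer`, with the bookkeeping `GateAscent`,
`EraseStabilize`) every gate triple is stably re-marked, by a Goeritz element, to a gate triple
whose free shadow is standard ON THE NOSE (`GoeritzPadding` ⇒ `LuftReduction`, proved here) — and
what is left is the residual `TwistGate` (a gate triple with `K₂N₁ = N₂N₁` is stably trivial; the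
crux on a sub-locus, `twistGate_of_crux`; SPC4-hard, declared).  v2 differs from v1 in taking the
research stub "Lemma R" (`GoeritzRealisesOutStab`: the Goeritz group realises the whole
`Out`-stabiliser of `P₀`) OFF the critical path: only the padding moves are realised.

Contents: §1 levels; §2 cut patterns and the erasure `eraseN1 : S m →* F_{3+3m}` (kernel `N m 1`);
§3 the free side (`P0`, `P2`, `partialConj`, `paddingGens`, `levelIncl`, `newStdGens`); §4 the
statements `GateAscent`, `FreePadding`, `goeritzInduced`/`MovesGoeritz`, `EraseStabilize`,
`GoeritzPadding`, `PaddingTransfer`, `FreeShadowStandard`, `LuftReduction`, `TwistGate`; §5 proved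
glue: `luftReduction_of_goeritzPadding`, **`NormalFormStablyTrivial_of`** (Nielsen ∧ GateAscent ∧
FreePadding ∧ MovesGoeritz ∧ EraseStabilize ∧ PaddingTransfer ∧ TwistGate ⇒ crux).  No `sorry`; the
seven stubs are proved in sibling files `…LuftStub*.lean` (`--supports stmt-SmoothPoincare4-14591`);
the calibration of the residual (`twistGate_of_crux`, twist-glued triples lie on its locus) is the
sibling `…LuftCalibration.lean`.

References: Luft, Math. Ann. 234 (1978); McCullough, Topology 24 (1985); McCool, J. Algebra 35
(1975); Abrams–Gay–Kirby, Geom. Topol. 22 (2018); Nielsen, Acta Math. 50 (1927);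
Zieschang–Vogt–Coldewey LNM 835 (1980) §3.2.
-/

-- the prescribed namespace `Summit.<P>.<Sub>.…` duplicates `SmoothPoincare4` (P = Sub)
set_option linter.dupNamespace false

noncomputable section

namespace Summit.SmoothPoincare4.SmoothPoincare4.Theorems.NormalFormStablyTrivial.Luft

open Literature.Topology.FourManifolds Literature.GroupTheory.CombinatorialGroupTheory Subgroup
open Summit.SmoothPoincare4.SmoothPoincare4.Theses.CongruenceShadows (NormalFormStablyTrivial)
open Summit.SmoothPoincare4.SmoothPoincare4.Theorems.NormalFormStablyTrivial.Negative
  (InGate normalFormStablyTrivial_iff_gate_of_nielsen isoInvariant_of_nielsen isStablyTrivial_of_inGate)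
open Summit.SmoothPoincare4.SmoothPoincare4.Theorems.AgkCor6Sufficiency.Negative
  (isStablyTrivial_cast_iff isStablyTrivial_of_stabilizeIter Iso.nonempty_tripleQuotient_equiv)
open Summit.SmoothPoincare4.SmoothPoincare4.Theorems.WaldhausenPairs.Negative
  (stabilizeIter_isGroupTrisection)
open Summit.SmoothPoincare4.SmoothPoincare4.Theorems.ShadowApproximation.NilpotentGenusClass
  (stabilizeIter_eq_cutKernel)

/-! ## §1 Levels (level `m`: genus `3 + 3m`, `N = s4Kernels.stabilizeIter m`) -/

/-- The surface group at level `m`: `S_{3+3m}`. -/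
abbrev S (m : ℕ) : Type := SurfaceGroup (3 + 3 * m)

/-- The standard kernel triple at level `m` (the genus-`3+3m` trisection of `S⁴`). -/
abbrev N (m : ℕ) : TrisectionKernels (3 + 3 * m) := s4Kernels.stabilizeIter m

/-- Genus bookkeeping for `n` further stabilisations at level `m`. -/
theorem level_add (m n : ℕ) : 3 + 3 * m + 3 * n = 3 + 3 * (m + n) := by ring

/-- Genus comparison between levels `m` and `m + n`. -/
theorem level_le (m n : ℕ) : 3 + 3 * m ≤ 3 + 3 * (m + n) := by omega

/-- The standard kernels are normal (the standard triple is a group trisection). -/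
instance normal_N (m : ℕ) (i : Fin 3) : (N m i).Normal := (stabilizeIter_isGroupTrisection m).normal i

/-! ## §2 Cut patterns and the erasure of the middle handlebody -/

/-- The cut pattern of slot `i` at level `m`: handle `j` is cut along `bⱼ` iff `j + i ≡ 2 (mod 3)`
(slot `0`: `b` on `j ≡ 2`; slot `1`: `b` on `j ≡ 1`; slot `2`: `b` on `j ≡ 0`; `aⱼ` elsewhere). -/
def cPat (m : ℕ) (i : Fin 3) : Fin (3 + 3 * m) → Bool :=
  fun j => decide ((((j : ℕ) + (i : ℕ)) % 3) = 2)

/-- **The standard kernels are cut kernels**: `N m i = cutKernel (cPat m i)` (cut normal form, proved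
in `…ShadowApproximationStubGoeritzRealisationPos.lean`). -/
theorem N_eq_cutKernel (m : ℕ) (i : Fin 3) : N m i = SurfaceGroup.cutKernel (cPat m i) :=
  stabilizeIter_eq_cutKernel m i

/-- **The erasure of the middle handlebody** `S m →* F_{3+3m} = π₁(H₁)`: kill the cut letters of
slot `1` and keep the other letter of every handle (`b̄_{3j} ↦ x_{3j}`, `ā_{3j+1} ↦ x_{3j+1}⁻¹`,
`b̄_{3j+2} ↦ x_{3j+2}`); the tree's erasure test `eraseA ∘ (cutSwapEquiv c)⁻¹` for `c = cPat m 1`. -/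
def eraseN1 (m : ℕ) : S m →* FreeGroup (Fin (3 + 3 * m)) :=
  (SurfaceGroup.eraseA).comp (SurfaceGroup.cutSwapEquiv (cPat m 1)).symm.toMonoidHom

/-- Unfolding `eraseN1`. -/
theorem eraseN1_apply (m : ℕ) (s : S m) :
    eraseN1 m s = SurfaceGroup.eraseA ((SurfaceGroup.cutSwapEquiv (cPat m 1)).symm s) := rfl

/-- **Kernel of the erasure**: `s ∈ N m 1 ↔ eraseN1 m s = 1`. -/
theorem mem_N_one_iff (m : ℕ) (s : S m) : s ∈ N m 1 ↔ eraseN1 m s = 1 := by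
  rw [N_eq_cutKernel, SurfaceGroup.mem_cutKernel_iff]
  rfl

/-- `ker (eraseN1 m) = N m 1`. -/
theorem ker_eraseN1 (m : ℕ) : (eraseN1 m).ker = N m 1 :=
  Subgroup.ext fun s => by rw [MonoidHom.mem_ker, mem_N_one_iff]

/-- The erasure is surjective (`xⱼ` is the image of the kept letter of handle `j`). -/
theorem eraseN1_surjective (m : ℕ) : Function.Surjective (eraseN1 m) := by
  intro w
  have hsec : (SurfaceGroup.eraseA (g := 3 + 3 * m)).comp
      (FreeGroup.lift fun i : Fin (3 + 3 * m) => SurfaceGroup.b i) = MonoidHom.id _ :=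
    FreeGroup.ext_hom _ _ fun i => by simp
  refine ⟨SurfaceGroup.cutSwapEquiv (cPat m 1) (FreeGroup.lift (fun i => SurfaceGroup.b i) w), ?_⟩
  rw [eraseN1_apply, MulEquiv.symm_apply_apply]
  exact DFunLike.congr_fun hsec w

/-- The erasure kills the cut letters of slot `1`. -/
theorem eraseN1_of_cut (m : ℕ) (j : Fin (3 + 3 * m)) :
    eraseN1 m (PresentedGroup.of (j, cPat m 1 j)) = 1 :=
  SurfaceGroup.erase_of_cut _ j

/-- The erasure on `bⱼ` for an `a`-cut handle: `xⱼ`. -/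
theorem eraseN1_b_of_eq_false (m : ℕ) {j : Fin (3 + 3 * m)} (h : cPat m 1 j = false) :
    eraseN1 m (SurfaceGroup.b j) = FreeGroup.of j :=
  SurfaceGroup.erase_b_of_eq_false _ h

/-- The erasure on `aⱼ` for a `b`-cut handle: `xⱼ⁻¹`. -/
theorem eraseN1_a_of_eq_true (m : ℕ) {j : Fin (3 + 3 * m)} (h : cPat m 1 j = true) :
    eraseN1 m (SurfaceGroup.a j) = (FreeGroup.of j)⁻¹ :=
  SurfaceGroup.erase_a_of_eq_true _ h

/-! ## §3 The free side: standard shadows, padding moves, level inclusion -/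

/-- The standard `(0,1)` shadow `P₀ = erase(N₀) = ⟪xᵢ : i ≢ 0 (mod 3)⟫` of `F_n` (the TRIVIAL
letters: `x_{3j+1} = y_j`, `x_{3j+2} = z_j`). -/
def P0 (n : ℕ) : Subgroup (FreeGroup (Fin n)) :=
  normalClosure (FreeGroup.of '' {i : Fin n | (i : ℕ) % 3 ≠ 0})

/-- The standard `(1,2)` shadow `P₂ = erase(N₂) = ⟪xᵢ : i ≢ 2 (mod 3)⟫` of `F_n`. -/
def P2 (n : ℕ) : Subgroup (FreeGroup (Fin n)) :=
  normalClosure (FreeGroup.of '' {i : Fin n | (i : ℕ) % 3 ≠ 2})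

/-- `P0 n` is normal. -/
instance normal_P0 (n : ℕ) : (P0 n).Normal := by unfold P0; infer_instance

/-- `P2 n` is normal. -/
instance normal_P2 (n : ℕ) : (P2 n).Normal := by unfold P2; infer_instance

/-- **Partial conjugation** `x_t ↦ x_j⁻¹ x_t x_j` (other basis elements fixed), an automorphism of
the free group (inverse `x_t ↦ x_j x_t x_j⁻¹`). -/
def partialConj {n : ℕ} (t j : Fin n) (h : t ≠ j) : MulAut (FreeGroup (Fin n)) :=
  replaceAut t ((FreeGroup.of j)⁻¹ * FreeGroup.of t * FreeGroup.of j)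
    (FreeGroup.of j * FreeGroup.of t * (FreeGroup.of j)⁻¹)
    (by simp only [map_mul, map_inv, replaceHom_of_self, replaceHom_of_ne h.symm]; group)
    (by simp only [map_mul, map_inv, replaceHom_of_self, replaceHom_of_ne h.symm]; group)

/-- `partialConj t j` on `x_t`. -/
@[simp] theorem partialConj_of_self {n : ℕ} {t j : Fin n} (h : t ≠ j) :
    partialConj t j h (FreeGroup.of t) = (FreeGroup.of j)⁻¹ * FreeGroup.of t * FreeGroup.of j :=
  replaceAut_of_self _ _ _ _ _

/-- `partialConj t j` fixes the other basis elements. -/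
@[simp] theorem partialConj_of_ne {n : ℕ} {t j i : Fin n} (h : t ≠ j) (hi : i ≠ t) :
    partialConj t j h (FreeGroup.of i) = FreeGroup.of i :=
  replaceAut_of_ne hi _ _ _ _

/-- **The padding moves** of `F_n`: right transvections `xᵢ ↦ xᵢ x_t` BY a trivial letter
(`t ≢ 0 (mod 3)`, `i ≠ t` arbitrary) and partial conjugations `x_t ↦ x_j⁻¹ x_t x_j` OF a trivial
letter (`j ≠ t` arbitrary).  Both preserve `P0 n`; the "trivial-over-essential" transvection
`x_t ↦ x_t xᵢ` (`i ≡ 0`) is deliberately absent (it leaves `Stab P₀`). -/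
def paddingGens (n : ℕ) : Set (MulAut (FreeGroup (Fin n))) :=
  {θ | ∃ (i t : Fin n) (h : i ≠ t), (t : ℕ) % 3 ≠ 0 ∧ θ = nielsenBeta i t h} ∪
    {θ | ∃ (t j : Fin n) (h : t ≠ j), (t : ℕ) % 3 ≠ 0 ∧ θ = partialConj t j h}

/-- A right transvection by a trivial letter is a padding move. -/
theorem nielsenBeta_mem_paddingGens {n : ℕ} {i t : Fin n} (h : i ≠ t) (ht : (t : ℕ) % 3 ≠ 0) :
    nielsenBeta i t h ∈ paddingGens n :=
  Or.inl ⟨i, t, h, ht, rfl⟩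

/-- A partial conjugation of a trivial letter is a padding move. -/
theorem partialConj_mem_paddingGens {n : ℕ} {t j : Fin n} (h : t ≠ j) (ht : (t : ℕ) % 3 ≠ 0) :
    partialConj t j h ∈ paddingGens n :=
  Or.inr ⟨t, j, h, ht, rfl⟩

/-- **Level inclusion** `F_{3+3m} →* F_{3+3(m+n)}` on the first `3+3m` letters (`xⱼ ↦ xⱼ`). -/
def levelIncl (m n : ℕ) : FreeGroup (Fin (3 + 3 * m)) →* FreeGroup (Fin (3 + 3 * (m + n))) :=
  FreeGroup.map (Fin.castLE (level_le m n))

/-- `levelIncl` on a letter. -/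
@[simp] theorem levelIncl_of (m n : ℕ) (j : Fin (3 + 3 * m)) :
    levelIncl m n (FreeGroup.of j) = FreeGroup.of (Fin.castLE (level_le m n) j) := by
  simp [levelIncl, FreeGroup.map.of]

/-- The standard generators of the `(1,2)` shadow on the NEW handles after `n` stabilisations at
level `m`: `{xᵢ : 3+3m ≤ i, i ≢ 2 (mod 3)}` (the new blocks of a stabilised `K₂` are standard:
they kill `x'`, `y'`). -/
def newStdGens (m n : ℕ) : Set (FreeGroup (Fin (3 + 3 * (m + n)))) :=
  FreeGroup.of '' {i : Fin (3 + 3 * (m + n)) | 3 + 3 * m ≤ (i : ℕ) ∧ (i : ℕ) % 3 ≠ 2}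

/-! ## §4 The statements -/

/-- **GATE ASCENT** (bookkeeping, modulo Nielsen via its stub): gate data ascend along
stabilisation — `K₀ = N₀`, `K₁ = N₁` by `stabilizeIter_add`, `π₁ = 1` by
`stabilize_isGroupTrisection_holds`, the two gate automorphisms by
`TrisectionKernels.iso_stabilize_map_of_lift` + Nielsen. -/
def GateAscent : Prop :=
  ∀ (m : ℕ) (K : TrisectionKernels (3 + 3 * m)) (n : ℕ), InGate m K →
    InGate (m + n) ((K.stabilizeIter n).cast (level_add m n))

/-- **FREE PADDING** (TRIAGE-r1-2 App. A; pure combinatorial group theory in free groups): for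
every automorphism `θ` of `F_{3+3m}` whose `(1,2)` shadow `Q = θ(P₂)` is transverse to `P₀`
(`P₀ ⊔ Q = ⊤`, i.e. `π₁ = 1`), after `m+1` block stabilisations the stabilised shadow
`Q' = ⟪ι Q ∪ new standard generators⟫` is the image of the standard one `P₂'` under a product of
padding moves. -/
def FreePadding : Prop :=
  ∀ (m : ℕ) (θ : MulAut (FreeGroup (Fin (3 + 3 * m)))),
    P0 (3 + 3 * m) ⊔ (P2 (3 + 3 * m)).map θ.toMonoidHom = ⊤ →
    ∃ v ∈ Subgroup.closure (paddingGens (3 + 3 * (m + (m + 1)))),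
      (P2 (3 + 3 * (m + (m + 1)))).map v.toMonoidHom =
        normalClosure (levelIncl m (m + 1) '' ((P2 (3 + 3 * m)).map θ.toMonoidHom : Set _) ∪
          newStdGens m (m + 1))

/-- **Automorphisms of `F_{3+3m}` induced by the Goeritz group** `Stab N₀ ∩ Stab N₁` through the
erasure `eraseN1` — a subgroup of `Aut F_{3+3m}`. -/
def goeritzInduced (m : ℕ) : Subgroup (MulAut (FreeGroup (Fin (3 + 3 * m)))) where
  carrier := {θ | ∃ x : S m ≃* S m, (N m 0).map x.toMonoidHom = N m 0 ∧
    (N m 1).map x.toMonoidHom = N m 1 ∧ ∀ s, eraseN1 m (x s) = θ (eraseN1 m s)}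
  one_mem' := ⟨MulEquiv.refl _, by simp, by simp, fun _ => rfl⟩
  mul_mem' := by
    rintro θ₁ θ₂ ⟨x₁, h₁0, h₁1, h₁⟩ ⟨x₂, h₂0, h₂1, h₂⟩
    refine ⟨x₂.trans x₁, ?_, ?_, fun s => ?_⟩
    · rw [show (x₂.trans x₁).toMonoidHom = x₁.toMonoidHom.comp x₂.toMonoidHom from rfl,
        ← Subgroup.map_map, h₂0, h₁0]
    · rw [show (x₂.trans x₁).toMonoidHom = x₁.toMonoidHom.comp x₂.toMonoidHom from rfl,
        ← Subgroup.map_map, h₂1, h₁1]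
    · rw [MulEquiv.trans_apply, h₁, h₂, MulAut.mul_apply]
  inv_mem' := by
    rintro θ ⟨x, h0, h1, h⟩
    have hc : x.symm.toMonoidHom.comp x.toMonoidHom = MonoidHom.id _ :=
      MonoidHom.ext fun s => x.symm_apply_apply s
    refine ⟨x.symm, ?_, ?_, fun s => ?_⟩
    · conv_lhs => rw [← h0]
      rw [Subgroup.map_map, hc, Subgroup.map_id]
    · conv_lhs => rw [← h1]
      rw [Subgroup.map_map, hc, Subgroup.map_id]
    · rw [MulAut.inv_apply, MulEquiv.eq_symm_apply, ← h, MulEquiv.apply_symm_apply]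

/-- Membership in `goeritzInduced m`. -/
theorem mem_goeritzInduced {m : ℕ} {θ : MulAut (FreeGroup (Fin (3 + 3 * m)))} :
    θ ∈ goeritzInduced m ↔ ∃ x : S m ≃* S m, (N m 0).map x.toMonoidHom = N m 0 ∧
      (N m 1).map x.toMonoidHom = N m 1 ∧ ∀ s, eraseN1 m (x s) = θ (eraseN1 m s) :=
  Iff.rfl

/-- **GOERITZ REALISATION OF THE PADDING MOVES**: every padding move of `F_{3+3m}` is induced by an
element of the Goeritz group `Stab N₀ ∩ Stab N₁` of the standard genus-`3(m+1)` Heegaard splitting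
of `#^{m+1} S¹×S²` (handle slides of `H₁` over trivial handles, corrected by meridian
transvections; annulus twists dragging a trivial handle). -/
def MovesGoeritz : Prop :=
  ∀ (m : ℕ), ∀ θ ∈ paddingGens (3 + 3 * m), θ ∈ goeritzInduced m

/-- **ERASURE OF A STABILISED TRIPLE** (bookkeeping): the `(1,2)` shadow of the `n`-fold
stabilisation of `K` is the level-included shadow of `K` together with the standard new generators. -/
def EraseStabilize : Prop :=
  ∀ (m n : ℕ) (K : TrisectionKernels (3 + 3 * m)), (K 2).Normal →
    (((K.stabilizeIter n).cast (level_add m n)) 2).map (eraseN1 (m + n)) =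
      normalClosure (levelIncl m n '' ((K 2).map (eraseN1 m) : Set _) ∪ newStdGens m n)

/-- **GOERITZ PADDING (stable, realised in the Goeritz group)**: a gate triple at level `m`
becomes, after `n` stabilisations, a gate triple whose `(1,2)` pair closure `K₂N₁` is the image of
the standard one `N₂N₁` under an element of `Stab N₀ ∩ Stab N₁`. -/
def GoeritzPadding : Prop :=
  ∀ (m : ℕ) (K : TrisectionKernels (3 + 3 * m)), InGate m K →
    ∃ (n : ℕ) (x : S (m + n) ≃* S (m + n)),
      InGate (m + n) ((K.stabilizeIter n).cast (level_add m n)) ∧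
      (N (m + n) 0).map x.toMonoidHom = N (m + n) 0 ∧
      (N (m + n) 1).map x.toMonoidHom = N (m + n) 1 ∧
      ((K.stabilizeIter n).cast (level_add m n)) 2 ⊔ N (m + n) 1 =
        (N (m + n) 2 ⊔ N (m + n) 1).map x.toMonoidHom

/-- **PADDING TRANSFER** (glue): gate ascent, free padding, Goeritz realisation of the moves and the
stabilised erasure together give Goeritz padding (read the free-group identity `v(P₂') = Q'` back in
`S` through `eraseN1`, whose kernel `N₁` lies in both sides). -/
def PaddingTransfer : Prop :=
  GateAscent → FreePadding → MovesGoeritz → EraseStabilize → GoeritzPadding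

/-- **Standard free shadow**: the `(1,2)` pair closure of `K` is the standard one ON THE NOSE. -/
def FreeShadowStandard (m : ℕ) (K : TrisectionKernels (3 + 3 * m)) : Prop :=
  K 2 ⊔ N m 1 = N m 2 ⊔ N m 1

/-- **LUFT REDUCTION (stable)**: every gate triple is stably isomorphic to a gate triple with
standard free shadow. -/
def LuftReduction : Prop :=
  ∀ (m : ℕ) (K : TrisectionKernels (3 + 3 * m)), InGate m K →
    ∃ (n : ℕ) (K' : TrisectionKernels (3 + 3 * (m + n))),
      InGate (m + n) K' ∧ FreeShadowStandard (m + n) K' ∧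
      TrisectionKernels.Iso ((K.stabilizeIter n).cast (level_add m n)) K'

/-- **TWIST GATE (the residual crux)**: a gate triple of the trivial group whose free shadow is
standard is stably trivial (geometrically: homotopy 4-spheres obtained from the standard trisection
of `S⁴` by regluing `H₂` through a Luft twist of `H₁` are standard).  SPC4 ⇒ crux ⇒ this. -/
def TwistGate : Prop :=
  ∀ (m : ℕ) (K : TrisectionKernels (3 + 3 * m)), InGate m K → FreeShadowStandard m K →
    K.IsStablyTrivial

/-! ## §5 Proved glue -/

variable {m : ℕ}

/-- `(α.trans β)` as a monoid hom is `β ∘ α`. -/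
theorem trans_toMonoidHom (α β : S m ≃* S m) :
    (α.trans β).toMonoidHom = β.toMonoidHom.comp α.toMonoidHom :=
  MonoidHom.ext fun _ => rfl

/-- If `x` fixes a subgroup, so does `x⁻¹`. -/
theorem map_symm_of_map_eq (x : S m ≃* S m) {M : Subgroup (S m)}
    (h : M.map x.toMonoidHom = M) : M.map x.symm.toMonoidHom = M := by
  have hc : x.symm.toMonoidHom.comp x.toMonoidHom = MonoidHom.id _ :=
    MonoidHom.ext fun s => x.symm_apply_apply s
  conv_lhs => rw [← h]
  rw [Subgroup.map_map, hc, Subgroup.map_id]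

/-- **Goeritz elements transport gate data**: if `x ∈ Stab N₀ ∩ Stab N₁` then `x⁻¹ K` is a gate
triple whenever `K` is. -/
theorem inGate_map_symm {K : TrisectionKernels (3 + 3 * m)} (hK : InGate m K) (x : S m ≃* S m)
    (hx0 : (N m 0).map x.toMonoidHom = N m 0) (hx1 : (N m 1).map x.toMonoidHom = N m 1) :
    InGate m (fun i => (K i).map x.symm.toMonoidHom) := by
  obtain ⟨h0, h1, hs, ⟨β, hb0, hb2⟩, ⟨γ, hc1, hc2⟩⟩ := hK
  have hxs0 := map_symm_of_map_eq x hx0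
  have hxs1 := map_symm_of_map_eq x hx1
  have hIso : TrisectionKernels.Iso K (fun i => (K i).map x.symm.toMonoidHom) :=
    ⟨x.symm, fun i => rfl⟩
  obtain ⟨e⟩ := Iso.nonempty_tripleQuotient_equiv hIso
  refine ⟨?_, ?_, ?_, ⟨β.trans x.symm, ?_, ?_⟩, ⟨γ.trans x.symm, ?_, ?_⟩⟩
  · show (K 0).map x.symm.toMonoidHom = N m 0
    rw [h0, hxs0]
  · show (K 1).map x.symm.toMonoidHom = N m 1
    rw [h1, hxs1]
  · haveI := hs
    exact e.symm.toEquiv.subsingleton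
  · rw [trans_toMonoidHom, ← Subgroup.map_map, hb0, hxs0]
  · rw [trans_toMonoidHom, ← Subgroup.map_map, hb2]
  · rw [trans_toMonoidHom, ← Subgroup.map_map, hc1, hxs1]
  · rw [trans_toMonoidHom, ← Subgroup.map_map, hc2]

/-- **GOERITZ PADDING ⇒ LUFT REDUCTION**: re-mark the padded triple by the inverse of the Goeritz
element; the `(1,2)` pair closure becomes standard on the nose. -/
theorem luftReduction_of_goeritzPadding (hP : GoeritzPadding) : LuftReduction := by
  intro m K hK
  obtain ⟨n, x, hKn, hx0, hx1, hsh⟩ := hP m K hK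
  have hxs1 := map_symm_of_map_eq x hx1
  have hc : x.symm.toMonoidHom.comp x.toMonoidHom = MonoidHom.id _ :=
    MonoidHom.ext fun s => x.symm_apply_apply s
  refine ⟨n, fun i => (((K.stabilizeIter n).cast (level_add m n)) i).map x.symm.toMonoidHom,
    inGate_map_symm hKn x hx0 hx1, ?_, ⟨x.symm, fun i => rfl⟩⟩
  show (((K.stabilizeIter n).cast (level_add m n)) 2).map x.symm.toMonoidHom ⊔ N (m + n) 1 =
    N (m + n) 2 ⊔ N (m + n) 1
  calc (((K.stabilizeIter n).cast (level_add m n)) 2).map x.symm.toMonoidHom ⊔ N (m + n) 1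
      = (((K.stabilizeIter n).cast (level_add m n)) 2).map x.symm.toMonoidHom ⊔
          (N (m + n) 1).map x.symm.toMonoidHom := by rw [hxs1]
    _ = (((K.stabilizeIter n).cast (level_add m n)) 2 ⊔ N (m + n) 1).map x.symm.toMonoidHom :=
          (Subgroup.map_sup _ _ _).symm
    _ = ((N (m + n) 2 ⊔ N (m + n) 1).map x.toMonoidHom).map x.symm.toMonoidHom := by rw [hsh]
    _ = N (m + n) 2 ⊔ N (m + n) 1 := by rw [Subgroup.map_map, hc, Subgroup.map_id]

/-- **THE COMPOSITION (skeleton v2): Nielsen ∧ GateAscent ∧ FreePadding ∧ MovesGoeritz ∧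
EraseStabilize ∧ PaddingTransfer ∧ TwistGate ⇒ the crux.**  Gate form by Nielsen; Goeritz padding
from the four middle stubs through the transfer; Luft reduction; twist gate; stable triviality
pulled back along the `Iso` (Nielsen) and down the stabilisations. -/
theorem NormalFormStablyTrivial_of :
    nielsen_surfaceGroup_mulEquiv_lift → GateAscent → FreePadding → MovesGoeritz →
      EraseStabilize → PaddingTransfer → TwistGate → NormalFormStablyTrivial := by
  intro hN hGA hFP hMG hES hPT hT
  rw [normalFormStablyTrivial_iff_gate_of_nielsen hN]
  intro m K hK
  obtain ⟨n, K', hK', hsh, hiso⟩ :=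
    luftReduction_of_goeritzPadding (hPT hGA hFP hMG hES) m K hK
  have h' : K'.IsStablyTrivial := hT (m + n) K' hK' hsh
  have h'' : ((K.stabilizeIter n).cast (level_add m n)).IsStablyTrivial :=
    isoInvariant_of_nielsen hN _ K' _ hiso.symm h'
  rw [isStablyTrivial_cast_iff] at h''
  exact isStablyTrivial_of_stabilizeIter K n h''

end Summit.SmoothPoincare4.SmoothPoincare4.Theorems.NormalFormStablyTrivial.Luft

end
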